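import Summits.CriticalPhenomena.SAWScalingLimit.Theorems.SAWRenewalTightnessConfinementPositivityPinnedNumeratorSteps
import Summits.CriticalPhenomena.SAWScalingLimit.Theorems.SAWRenewalTightnessConfinementPositivityUnpinnedSlabTube
import HarnessLib

/-!
# Crux `ConfinementPositivity` (stmt-CriticalPhenomena-17587), line `Sketch` (sign-universality):
# stub Num `stub_pinnedNumerator` — UnpinnedSlabTube → HeightLocalRichness → SmallPiecesCeiling → PinnedTubeFloor

Registered stub Num of the lead skeleton `Cruxes/ConfinementPositivity/Lines/Sketch.lean` (v4).  Kesten chains are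
lists of irreducible bridge words (pieces) weighted by `x_c^{Σ|pieces|}`; `u_n` is the mass of the chains of total
span `n`.  CLAIM (PinnedTubeFloor): for every aspect `α ≥ 1` there are `c > 0` and `W₀` such that for `W ≥ W₀`,
`L ≤ αW`, `W ≤ α(L+1)`, `|y₀|, |y₁| ≤ W/2`, the chains of span `n = L + 1` started at height `y₀` that END at `y₁` and
stay in `|y| ≤ W` carry mass `≥ (c/n)·u_n`.

Proof (one steering piece; parts 1–2 in `…PinnedNumeratorLemmas.lean`, `…PinnedNumeratorSteps.lean`).  Fix
`K = ⌈2C_U⌉₊ + 1` (`2C_U ≤ K²`), `c₁` = the unpinned-slab-tube constant at aspect `16(α+1)`, `(s₀, c_L)` = the LR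
constants at `A = 2αK`, `D = 8(α+1)`, `W₀ = 16 + αK(s₀+1)`, `c = c₁² c_L/(2K)`, `r = ⌊W/8⌋`.  Consider the triples
`(A, B, π)`: a prefix chain `A` in the tube `r` about its start, a suffix chain `B` likewise, and ONE steering piece
`π` with `n ≤ K·span`, total span `n`, height `y₁ - y₀ - Y_A - Y_B` and overshoot `≤ span/D`.
(1) Multiplicity (`PinnedNum.mult_step`): the glued chain `A ++ π :: B` is pinned at `y₁` inside `|y| ≤ W`
(`pinnedNum_tube_of_pieces`) and arises from at most `K` triples, so the triples weigh `≤ K ·` (pinned tube mass).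
(2) LR step (`PinnedNum.lr_step3`): un-pinning the steering piece costs `c_L/n`.  (3) H1 step (`PinnedNum.h1_step`):
removing the tubes on `A` and `B` costs `c₁²`, leaving `R' = Σ_{(A,B,π): span n, n ≤ K·span π} w`.  (4) Coverage
(`PinnedNum.cover_step`): `u_n ≤ R' + mass{all pieces K·span < n} ≤ R' + (C_U/K²) u_n ≤ R' + u_n/2` (cut at the
first big piece, `PinnedNum.big_le_triple`; USP; `u_n ≤ n + 1 < ∞`), so `u_n ≤ 2R'`.  Hence
`K · pinned ≥ (c_L/n) c₁² R' ≥ (c_L c₁²/(2n)) u_n`.  All in `ℝ≥0∞`; no definitions.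
-/

noncomputable section

open scoped BigOperators ENNReal
open Classical
open Literature.Probability.LatticeModels
open Literature.Probability.RandomPlanarGeometry Literature.Probability.RandomPlanarGeometry.SAW

namespace Summit.CriticalPhenomena.SAWScalingLimit.Theorems

namespace PinnedNum

/-! ### The multiplicity step and the coverage step, instantiated -/

/-- **Multiplicity step.**  The admissible triples glue to chains of span `n` pinned at `y₁ - y₀` inside the tube
`|y₀ + y| ≤ W` (`pinnedNum_tube_of_pieces`), each arising from at most `K` triples. -/
theorem mult_step (n K W r D : ℕ) (y₀ y₁ : ℤ) (hn : 1 ≤ n) (hy₀ : 2 * |y₀| ≤ (W : ℤ)) (hy₁ : 2 * |y₁| ≤ (W : ℤ))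
    (hr : 8 * r ≤ W) (hD : 1 ≤ D) (h8n : 8 * (n : ℤ) ≤ 3 * (D : ℤ) * (W : ℤ)) :
    (∑' A : List (List Step), ∑' B : List (List Step), ∑' π : List Step,
        if ((((∀ w ∈ A, IsIrrBridge w) ∧ ∀ i, |traj A.flatten i 1| ≤ (r : ℤ)) ∧
            ((∀ w ∈ B, IsIrrBridge w) ∧ ∀ i, |traj B.flatten i 1| ≤ (r : ℤ))) ∧ (IsIrrBridge π ∧
            (A.map xEnd).sum + xEnd π + (B.map xEnd).sum = n ∧ (n : ℤ) ≤ (K : ℤ) * xEnd π ∧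
            wEnd π 1 = y₁ - y₀ - wEnd A.flatten 1 - wEnd B.flatten 1 ∧
            ∀ i, (D : ℤ) * min (y₁ - y₀ - wEnd A.flatten 1 - wEnd B.flatten 1) 0 - xEnd π ≤ (D : ℤ) * traj π i 1 ∧
              (D : ℤ) * traj π i 1 ≤ (D : ℤ) * max (y₁ - y₀ - wEnd A.flatten 1 - wEnd B.flatten 1) 0 + xEnd π)) then
          ENNReal.ofReal (criticalFugacity ^ (A.map List.length).sum) *
            ENNReal.ofReal (criticalFugacity ^ (B.map List.length).sum) *
              ENNReal.ofReal (criticalFugacity ^ π.length) else 0) ≤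
      K * ∑' m : List (List Step), if ((∀ w ∈ m, IsIrrBridge w) ∧ (m.map xEnd).sum = n ∧
          (y₀ + wEnd m.flatten 1 = y₁ ∧ ∀ i, |y₀ + traj m.flatten i 1| ≤ (W : ℤ))) then
        ENNReal.ofReal (criticalFugacity ^ (m.map List.length).sum) else 0 := by
  refine triple_le_mul_target (n : ℤ) (by exact_mod_cast hn) K _ _ fun A B π hc => ?_
  obtain ⟨⟨⟨hA, htA⟩, hB, htB⟩, hπ, hs, hbig, hH, hOS⟩ := hc
  refine ⟨hA, hB, hπ, hs, hbig, ?_⟩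
  have h8s : 8 * xEnd π ≤ 3 * (D : ℤ) * (W : ℤ) := by
    have := span_nonneg A hA
    have := span_nonneg B hB
    linarith
  have key := pinnedNum_tube_of_pieces A.flatten π B.flatten y₀ y₁ W r (D : ℤ) (xEnd π) htA htB hH hOS hy₀ hy₁
    (by exact_mod_cast hr) (by exact_mod_cast hD) h8s
  simpa only [List.flatten_append, List.flatten_cons] using key

/-- **Coverage step.**  `u_n ≤ 2 R'`: a chain of span `n` either has a member with `n ≤ K · span` (mass `≤ R'` by
`big_le_triple`) or all its members have `K · span < n` (mass `≤ (C_U/K²) u_n ≤ u_n / 2` by USP and `2 C_U ≤ K²`);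
`u_n < ∞`. -/
theorem cover_step (n K : ℕ) (C : ℝ) (hK : 1 ≤ K) (hCK : 2 * C ≤ (K : ℝ) ^ 2)
    (husp : (K : ℝ≥0∞) ^ 2 * (∑' m : List (List Step), if ((∀ w ∈ m, IsIrrBridge w) ∧ (m.map xEnd).sum = n ∧
        ∀ w ∈ m, (K : ℤ) * xEnd w < (n : ℤ)) then ENNReal.ofReal (criticalFugacity ^ (m.map List.length).sum) else 0) ≤
      ENNReal.ofReal C * ∑' m : List (List Step), if ((∀ w ∈ m, IsIrrBridge w) ∧ (m.map xEnd).sum = n ∧ True) then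
        ENNReal.ofReal (criticalFugacity ^ (m.map List.length).sum) else 0)
    (hfin : (∑' m : List (List Step), if ((∀ w ∈ m, IsIrrBridge w) ∧ (m.map xEnd).sum = n ∧ True) then
        ENNReal.ofReal (criticalFugacity ^ (m.map List.length).sum) else 0) ≠ ⊤) :
    (∑' m : List (List Step), if ((∀ w ∈ m, IsIrrBridge w) ∧ (m.map xEnd).sum = n ∧ True) then
        ENNReal.ofReal (criticalFugacity ^ (m.map List.length).sum) else 0) ≤
      2 * ∑' A : List (List Step), ∑' B : List (List Step), ∑' π : List Step,
        if (((∀ w ∈ A, IsIrrBridge w) ∧ ∀ w ∈ B, IsIrrBridge w) ∧ (IsIrrBridge π ∧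
            (A.map xEnd).sum + xEnd π + (B.map xEnd).sum = n ∧ (n : ℤ) ≤ (K : ℤ) * xEnd π)) then
          ENNReal.ofReal (criticalFugacity ^ (A.map List.length).sum) *
            ENNReal.ofReal (criticalFugacity ^ (B.map List.length).sum) *
              ENNReal.ofReal (criticalFugacity ^ π.length) else 0 := by
  set u := ∑' m : List (List Step), if ((∀ w ∈ m, IsIrrBridge w) ∧ (m.map xEnd).sum = n ∧ True) then
    ENNReal.ofReal (criticalFugacity ^ (m.map List.length).sum) else 0 with hu
  set small := ∑' m : List (List Step), if ((∀ w ∈ m, IsIrrBridge w) ∧ (m.map xEnd).sum = n ∧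
    ∀ w ∈ m, (K : ℤ) * xEnd w < (n : ℤ)) then ENNReal.ofReal (criticalFugacity ^ (m.map List.length).sum) else 0
    with hsmall
  set big := ∑' m : List (List Step), if ((∀ w ∈ m, IsIrrBridge w) ∧ (m.map xEnd).sum = n ∧
    ∃ w ∈ m, (n : ℤ) ≤ (K : ℤ) * xEnd w) then ENNReal.ofReal (criticalFugacity ^ (m.map List.length).sum) else 0
    with hbig
  have hcover : u ≤ big + small := by
    rw [hu, hbig, hsmall, ← ENNReal.tsum_add]
    refine ENNReal.tsum_le_tsum fun m => ?_
    by_cases h1 : (∀ w ∈ m, IsIrrBridge w) ∧ (m.map xEnd).sum = n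
    · by_cases hex : ∃ w ∈ m, (n : ℤ) ≤ (K : ℤ) * xEnd w
      · rw [if_pos ⟨h1.1, h1.2, trivial⟩, if_pos ⟨h1.1, h1.2, hex⟩]
        exact le_self_add
      · have hsm : ∀ w ∈ m, (K : ℤ) * xEnd w < (n : ℤ) := fun w hw => not_le.1 fun hle => hex ⟨w, hw, hle⟩
        rw [if_pos ⟨h1.1, h1.2, trivial⟩, if_neg fun h => hex h.2.2, if_pos ⟨h1.1, h1.2, hsm⟩]
        exact le_add_self
    · rw [if_neg fun h => h1 ⟨h.1, h.2.1⟩]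
      exact zero_le
  have h2s : 2 * small ≤ u := by
    have hK0 : (K : ℝ≥0∞) ^ 2 ≠ 0 := pow_ne_zero _ (Nat.cast_ne_zero.2 (by omega))
    have hKt : (K : ℝ≥0∞) ^ 2 ≠ ⊤ := ENNReal.pow_ne_top (ENNReal.natCast_ne_top K)
    rw [← ENNReal.mul_le_mul_iff_right hK0 hKt]
    calc (K : ℝ≥0∞) ^ 2 * (2 * small) = 2 * ((K : ℝ≥0∞) ^ 2 * small) := by ring
      _ ≤ 2 * (ENNReal.ofReal C * u) := mul_le_mul' le_rfl husp
      _ = ENNReal.ofReal (2 * C) * u := by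
          rw [ENNReal.ofReal_mul (by norm_num), ENNReal.ofReal_ofNat, mul_assoc]
      _ ≤ (K : ℝ≥0∞) ^ 2 * u := by
          refine mul_le_mul' ?_ le_rfl
          calc ENNReal.ofReal (2 * C) ≤ ENNReal.ofReal ((K : ℝ) ^ 2) := ENNReal.ofReal_le_ofReal hCK
            _ = (K : ℝ≥0∞) ^ 2 := by rw [ENNReal.ofReal_pow (Nat.cast_nonneg _), ENNReal.ofReal_natCast]
  have hbigR := big_le_triple (n : ℤ) K
  have h3 : u + u ≤ 2 * big + u :=
    calc u + u ≤ (big + small) + (big + small) := add_le_add hcover hcover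
      _ = 2 * big + 2 * small := by ring
      _ ≤ 2 * big + u := add_le_add le_rfl h2s
  exact (ENNReal.le_of_add_le_add_right hfin h3).trans (mul_le_mul' le_rfl hbigR)

/-- The constant of Num: `K · (c₁² c_L / (2K) / n) · 2 = (c_L / n) · c₁²`. -/
theorem const_eq (c₁ cL : ℝ) (hc₁ : 0 ≤ c₁) (hcL : 0 ≤ cL) (K n : ℕ) (hK : 1 ≤ K) (hn : 1 ≤ n) :
    (K : ℝ≥0∞) * ENNReal.ofReal (c₁ ^ 2 * cL / (2 * K) / n) * 2 = ENNReal.ofReal (cL / n) * ENNReal.ofReal c₁ ^ 2 := by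
  rw [← ENNReal.ofReal_natCast K, ← ENNReal.ofReal_ofNat 2, ← ENNReal.ofReal_mul (by positivity),
    ← ENNReal.ofReal_mul (by positivity), ← ENNReal.ofReal_pow hc₁, ← ENNReal.ofReal_mul (by positivity)]
  congr 1
  have hK' : (K : ℝ) ≠ 0 := by exact_mod_cast (show K ≠ 0 by omega)
  have hn' : (n : ℝ) ≠ 0 := by exact_mod_cast (show n ≠ 0 by omega)
  field_simp

end PinnedNum

open PinnedNum in
/-- **Stub Num `stub_pinnedNumerator`** (registered): UnpinnedSlabTube → HeightLocalRichness → SmallPiecesCeiling →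
PinnedTubeFloor.  For `W ≥ W₀(α) = 16 + αK(s₀+1)`, two-sided aspect `L ≤ αW`, `W ≤ α(L+1)` and `|y₀|, |y₁| ≤ W/2`,
the Kesten chains of span `L + 1` started at height `y₀` that end at `y₁` inside `|y| ≤ W` carry mass
`≥ (c/(L+1))·u_{L+1}` with `c = c₁² c_L/(2K)` (`c₁`: unpinned slab tube at aspect `16(α+1)`; `(s₀, c_L)`: LR at
`A = 2αK`, `D = 8(α+1)`; `K = ⌈2C_U⌉₊ + 1`). -/
theorem stub_pinnedNumerator :
    (∀ a : ℕ, 1 ≤ a → ∃ c : ℝ, 0 < c ∧ ∀ W L : ℕ, 1 ≤ W → L ≤ a * W →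
      ENNReal.ofReal c *
          (∑' l : {l : List (List Step) // (∀ w ∈ l, IsIrrBridge w) ∧ (l.map xEnd).sum = (L : ℤ) ∧ True},
            ENNReal.ofReal (criticalFugacity ^ (l.1.map List.length).sum)) ≤
        ∑' l : {l : List (List Step) // (∀ w ∈ l, IsIrrBridge w) ∧ (l.map xEnd).sum = (L : ℤ) ∧
            ∀ i, |traj l.flatten i 1| ≤ (W : ℤ)},
          ENNReal.ofReal (criticalFugacity ^ (l.1.map List.length).sum)) →
    (∀ A D : ℕ, 1 ≤ A → 1 ≤ D → ∃ s₀ : ℕ, ∃ c : ℝ, 0 < c ∧ ∀ s : ℕ, s₀ ≤ s → ∀ h : ℤ, |h| ≤ ((A * s : ℕ) : ℤ) →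
      c / s * (∑' w : {w : List Step // IsIrrBridge w},
          {w : {w : List Step // IsIrrBridge w} | xEnd w.1 = s}.indicator
            (fun w => criticalFugacity ^ w.1.length) w) ≤
        ∑' w : {w : List Step // IsIrrBridge w},
          {w : {w : List Step // IsIrrBridge w} | xEnd w.1 = s ∧ wEnd w.1 1 = h ∧
              ∀ i, (D : ℤ) * min h 0 - (s : ℤ) ≤ (D : ℤ) * traj w.1 i 1 ∧
                (D : ℤ) * traj w.1 i 1 ≤ (D : ℤ) * max h 0 + (s : ℤ)}.indicator
            (fun w => criticalFugacity ^ w.1.length) w) →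
    (∃ C : ℝ, 0 < C ∧ ∀ K n : ℕ, 1 ≤ K →
      (K : ℝ≥0∞) ^ 2 *
          (∑' l : {l : List (List Step) // (∀ w ∈ l, IsIrrBridge w) ∧ (l.map xEnd).sum = (n : ℤ) ∧
              ∀ w ∈ l, (K : ℤ) * xEnd w < (n : ℤ)},
            ENNReal.ofReal (criticalFugacity ^ (l.1.map List.length).sum)) ≤
        ENNReal.ofReal C *
          ∑' l : {l : List (List Step) // (∀ w ∈ l, IsIrrBridge w) ∧ (l.map xEnd).sum = (n : ℤ) ∧ True},
            ENNReal.ofReal (criticalFugacity ^ (l.1.map List.length).sum)) →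
    (∀ α : ℕ, 1 ≤ α → ∃ c : ℝ, 0 < c ∧ ∃ W₀ : ℕ, ∀ (L W : ℕ) (y₀ y₁ : ℤ), W₀ ≤ W → L ≤ α * W →
      W ≤ α * (L + 1) → 2 * |y₀| ≤ (W : ℤ) → 2 * |y₁| ≤ (W : ℤ) →
      ENNReal.ofReal (c / (L + 1 : ℕ)) *
          (∑' l : {l : List (List Step) // (∀ w ∈ l, IsIrrBridge w) ∧ (l.map xEnd).sum = ((L + 1 : ℕ) : ℤ) ∧ True},
            ENNReal.ofReal (criticalFugacity ^ (l.1.map List.length).sum)) ≤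
        ∑' l : {l : List (List Step) // (∀ w ∈ l, IsIrrBridge w) ∧ (l.map xEnd).sum = ((L + 1 : ℕ) : ℤ) ∧
            (y₀ + wEnd l.flatten 1 = y₁ ∧ ∀ i, |y₀ + traj l.flatten i 1| ≤ (W : ℤ))},
          ENNReal.ofReal (criticalFugacity ^ (l.1.map List.length).sum)) := by
  intro hH1 hLR hUSP α hα
  obtain ⟨CU, hCU, husp⟩ := hUSP
  -- the multiplicity `K` with `2 C_U ≤ K²`
  obtain ⟨K, hK, hKC⟩ : ∃ K : ℕ, 1 ≤ K ∧ 2 * CU ≤ (K : ℝ) ^ 2 := by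
    refine ⟨⌈2 * CU⌉₊ + 1, by omega, ?_⟩
    have h1 : 2 * CU ≤ (⌈2 * CU⌉₊ : ℝ) := Nat.le_ceil _
    have h2 : (0 : ℝ) ≤ (⌈2 * CU⌉₊ : ℝ) := Nat.cast_nonneg _
    push_cast
    nlinarith
  obtain ⟨c₁, hc₁, h1⟩ := hH1 (16 * (α + 1)) (by omega)
  obtain ⟨s₀, cL, hcL, hlr⟩ := hLR (2 * α * K) (8 * (α + 1))
    (Nat.succ_le_of_lt (Nat.mul_pos (Nat.mul_pos (by norm_num) hα) hK)) (by omega)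
  refine ⟨c₁ ^ 2 * cL / (2 * K), by positivity, 16 + α * K * (s₀ + 1), ?_⟩
  intro L W y₀ y₁ hW₀ hL hWL hy₀ hy₁
  -- the regime
  have hW16 : 16 ≤ W := le_trans (Nat.le_add_right 16 _) hW₀
  have hs₀W : α * K * s₀ ≤ W := by
    have : α * K * s₀ ≤ α * K * (s₀ + 1) := Nat.mul_le_mul_left _ (Nat.le_succ _)
    omega
  have hr8 : 8 * (W / 8) ≤ W := Nat.mul_div_le W 8
  have hr1 : 1 ≤ W / 8 := by omega
  have h16r : W + 2 ≤ 16 * (W / 8) := by omega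
  have hn_asp : L + 1 ≤ 16 * (α + 1) * (W / 8) := by
    have e : (α + 1) * (W + 2) = α * W + W + 2 * α + 2 := by ring
    calc L + 1 ≤ (α + 1) * (W + 2) := by rw [e]; omega
      _ ≤ (α + 1) * (16 * (W / 8)) := Nat.mul_le_mul_left _ h16r
      _ = 16 * (α + 1) * (W / 8) := by ring
  have h8n : 8 * ((L + 1 : ℕ) : ℤ) ≤ 3 * ((8 * (α + 1) : ℕ) : ℤ) * (W : ℤ) := by
    have e : 3 * (8 * (α + 1)) * W = 24 * (α * W) + 24 * W := by ring
    have h : 8 * (L + 1) ≤ 3 * (8 * (α + 1)) * W := by rw [e]; omega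
    exact_mod_cast h
  -- the list presentation
  rw [chainSpanMass_eq_tsum_list, chainSpanMass_eq_tsum_list]
  -- the four steps
  have step1 := mult_step (L + 1) K W (W / 8) (8 * (α + 1)) y₀ y₁ (Nat.succ_pos L) hy₀ hy₁ hr8 (by omega) h8n
  have step2 := lr_step3 K α s₀ (8 * (α + 1)) (L + 1) W (W / 8) cL hcL.le hK hα hlr hs₀W hWL y₀ y₁ hy₀ hy₁ hr8
  have step3 := h1_step (L + 1) K (W / 8) c₁
    (tubeFloor_int (16 * (α + 1)) (W / 8) (L + 1) c₁ hn_asp fun L' hL' => h1 (W / 8) L' hr1 hL')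
  have husp' := husp K (L + 1) hK
  rw [chainSpanMass_eq_tsum_list, chainSpanMass_eq_tsum_list] at husp'
  have hfin : (∑' m : List (List Step), if ((∀ w ∈ m, IsIrrBridge w) ∧ (m.map xEnd).sum = ((L + 1 : ℕ) : ℤ) ∧ True)
      then ENNReal.ofReal (criticalFugacity ^ (m.map List.length).sum) else 0) ≠ ⊤ := by
    rw [← chainSpanMass_eq_tsum_list, chainSpanMass_eq_tsum_tuples]
    simp only [and_true]
    exact ne_top_of_le_ne_top (by simp) (UnpinnedSlabTube.tsum_tsum_span_le (L + 1))
  have step4 := cover_step (L + 1) K CU hK hKC husp' hfin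
  -- assembly: multiply by `K` and chain
  have hK0 : (K : ℝ≥0∞) ≠ 0 := Nat.cast_ne_zero.2 (by omega)
  have hKt : (K : ℝ≥0∞) ≠ ⊤ := ENNReal.natCast_ne_top K
  rw [← ENNReal.mul_le_mul_iff_right hK0 hKt]
  refine le_trans ?_ step1
  refine le_trans ?_ step2
  refine le_trans ?_ (mul_le_mul' le_rfl step3)
  refine le_trans (mul_le_mul' le_rfl (mul_le_mul' le_rfl step4)) (le_of_eq ?_)
  conv_rhs => rw [← mul_assoc, ← const_eq c₁ cL hc₁.le hcL.le K (L + 1) hK (Nat.succ_pos L)]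
  ring

end Summit.CriticalPhenomena.SAWScalingLimit.Theorems
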